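import Summits.FinalStateConjecture.FinalStateConjecture.Theses.PhaseMixingCapture
import Summits.FinalStateConjecture.FinalStateConjecture.Theorems.BulkKerrCapture.Negative.SpinGapAndMass

/-!
# `CaptureSuffices` (item `stmt-FinalStateConjecture-9953`, route `PhaseMixingCapture`, support,
# rank 6): its exact logical position after the typing ruling of 2026-08-16

`CaptureSuffices := NearExtremalKappaCapture → BulkKerrCapture → WeakCosmicCensorshipMGHD →
FinalStateConjecture` is the PRE-RULING form of the route's front-end conditional. Since rev 15/16
the deciding theorem `closes` takes the successor `CaptureSufficesC2 := NearExtremalKappaCapture →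
BulkKerrCaptureC2 → WeakCosmicCensorshipMGHD → FinalStateConjecture` (item 14986) instead, fed by the
successor bulk statement `BulkKerrCaptureC2` (item 14985, convergence order pinned to `k = 2`);
`CaptureSuffices` stays in the route file as an implication record. This file records, sorry-free
and without new definitions, what the record is worth:

* `captureSuffices_of_finalStateConjecture` — the summit statement implies it (so `¬ CaptureSuffices`
  refutes the summit; cf. `CaptureSuffices.Negative.not_captureSuffices_iff`).
* `captureSuffices_of_captureSufficesC2` — **granted the rank-4 successor `BulkKerrCaptureC2`, the
  item follows from the rank-6 successor `CaptureSufficesC2` by modus ponens** (its own hypothesis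
  `BulkKerrCapture` is then idle). This is the closing recipe: the item closes the moment items
  14985 and 14986 both do.
* `captureSuffices_of_bulkUpgrade` — the planner's sentence "implied by `CaptureSufficesC2` given a
  `C⁰ → C²` upgrade of bulk capture" with the upgrade as the implication
  `BulkKerrCapture → BulkKerrCaptureC2`.
* `bulkKerrCaptureC2_iff` — the successor bulk statement in `CaptureAt`-style block form (the
  inlined sojourn clause is `HasCompleteFutureNullInfinityFar`, as in
  `BulkKerrCapture.Negative.bulkKerrCapture_iff`).
* `captureAt_anti` — the block `CaptureAt s δ k …` is antitone in the convergence order `k`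
  (`Spacetime.ConvergesTo.of_le`), the formal reason the existential `k` of `BulkKerrCapture` hands a
  consumer only `k = 0`.
* `bulkKerrCaptureC2_of_captureAt_two` — **the `k := 2` member of the `BulkKerrCapture` family
  implies `BulkKerrCaptureC2`**: the Lipschitz modulus `|M' − M| + |a' − a| ≤ C √dist` gives the
  qualitative `∀ η ∃ ε` modulus with `ε' = min ε (η / (|C| + 1))²`, and the b-conormality side
  condition of the successor is simply not used. Hence (`captureSuffices_of_captureUpgrade`) the
  old-light line's registered stub signature `CaptureUpgrade` (`CaptureAt s δ 0 … → CaptureAt s δ 2 …`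
  at every package) turns `BulkKerrCapture` into `BulkKerrCaptureC2`, and `CaptureSufficesC2` into
  `CaptureSuffices` — the kernel-checked form of the route file's Assembly note.

Nothing here is analysis; the mathematical content of the item (approach of generic exteriors to
the Kerr family, no parking at extremality, multi-hole bookkeeping, exhaustive charts) is the open
large-data front end of the final state conjecture and is carried entirely by item 14986.
-/

-- the doubled `FinalStateConjecture.FinalStateConjecture` path component trips dupNamespace
set_option linter.dupNamespace false

noncomputable section

open Set
open scoped Manifold ENNReal ContDiff

namespace Summit.FinalStateConjecture.FinalStateConjecture.Theorems.PhaseMixingCaptureCaptureSuffices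

open Literature.Geometry.Lorentzian
open Summit.FinalStateConjecture.FinalStateConjecture.Theses.PhaseMixingCapture
open Summit.FinalStateConjecture.FinalStateConjecture.Theorems.BulkKerrCapture.Negative
  (CaptureAt bulkKerrCapture_iff range_farSliceIncl)

/-! ## §1 Pure logic -/

/-- **Necessity**: the summit statement implies the item (drop the three hypotheses). [folklore] -/
theorem captureSuffices_of_finalStateConjecture : FinalStateConjecture → CaptureSuffices :=
  fun h _ _ _ ↦ h

/-- **Closing recipe through the successors**: granted the rank-4 successor `BulkKerrCaptureC2`
(item stmt-FinalStateConjecture-14985), the rank-6 successor `CaptureSufficesC2`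
(item stmt-FinalStateConjecture-14986) implies the item; its own bulk hypothesis is idle. [folklore] -/
theorem captureSuffices_of_captureSufficesC2 :
    BulkKerrCaptureC2 → CaptureSufficesC2 → CaptureSuffices :=
  fun hB hS hN _ hW ↦ hS hN hB hW

/-- **Upgrade form** (route file, Assembly note): `CaptureSufficesC2` and a `C⁰ → C²` upgrade of bulk
capture, read as the implication `BulkKerrCapture → BulkKerrCaptureC2`, give the item. [folklore] -/
theorem captureSuffices_of_bulkUpgrade (hup : BulkKerrCapture → BulkKerrCaptureC2)
    (hS : CaptureSufficesC2) : CaptureSuffices :=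
  fun hN hB hW ↦ hS hN (hup hB) hW

/-! ## §2 The successor bulk statement in block form -/

/-- **`BulkKerrCaptureC2` in block form.** The inlined sojourn clause of the route decl is, after
`range_farSliceIncl`, literally `DataEmbedding.HasCompleteFutureNullInfinityFar`; the rest is
verbatim. [folklore] -/
theorem bulkKerrCaptureC2_iff :
    BulkKerrCaptureC2 ↔
      ∀ [Kerr.Facts] [Kerr.SliceFacts], ∀ a₁ : ℝ, a₁ < 1 → ∃ (s : ℕ) (δ : ℝ),
        ∀ (M : ℝ) (hM : 0 < M), ∀ η > (0 : ℝ), ∃ ε > (0 : ℝ), ∀ a : ℝ, |a| ≤ a₁ * M →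
          ∀ (D : InitialDataSet 𝓘(ℝ, E3) (Kerr.slice a M)) [D.metric.HasLeviCivita],
            D.IsVacuumConstraintSolution →
            (∀ s' : ℕ, InitialDataSet.dataWeightedSobolevEDist s' δ D (Kerr.data M a M hM.le) < ⊤) →
            InitialDataSet.dataWeightedSobolevEDist s δ D (Kerr.data M a M hM.le) <
              ENNReal.ofReal ε →
            ∀ 𝒟 : VacuumCauchyDevelopment D, 𝒟.IsMaximal →
              ∃ (M' a' : ℝ) (𝒟oc : Set 𝒟.carrier), Kerr.IsSubextremal M' a' ∧
                𝒟.HasCompleteFutureNullInfinityFar ∧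
                𝒟.toSpacetime.ConvergesToKerr 𝒟oc M' a' 2 ∧ |M' - M| + |a' - a| ≤ η := by
  simp only [BulkKerrCaptureC2, DataEmbedding.HasCompleteFutureNullInfinityFar,
    DataEmbedding.HasCompleteFutureNullInfinityFrom, range_farSliceIncl]

/-! ## §3 The convergence order: antitone blocks and the `k := 2` member -/

/-- The block `CaptureAt s δ k M ε C a` is **antitone in the convergence order** `k`: `Cᵏ`
convergence to Kerr implies `Cᵏ'` convergence for `k' ≤ k` (`Spacetime.ConvergesTo.of_le`), in the
same chart. This is why the existential `k` of `BulkKerrCapture` is worth exactly `k = 0` to a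
consumer (`CaptureSuffices.Negative.bulkKerrCapture_iff_sharp`). [folklore] -/
theorem captureAt_anti [Kerr.Facts] [Kerr.SliceFacts] {s : ℕ} {δ : ℝ} {k k' : ℕ} (hk : k' ≤ k)
    {M : ℝ} {hM : 0 ≤ M} {ε C a : ℝ} (h : CaptureAt s δ k M hM ε C a) :
    CaptureAt s δ k' M hM ε C a := by
  intro D _ hvac hdist 𝒟 hmax
  obtain ⟨M', a', 𝒟oc, hsub, hfar, hconv, hmod⟩ := h D hvac hdist 𝒟 hmax
  exact ⟨M', a', 𝒟oc, hsub, hfar, Spacetime.ConvergesTo.of_le hconv hk, hmod⟩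

/-- Arithmetic of the modulus: if `dist < ofReal (min ε (η / (|C| + 1)) ^ 2)` then
`C · √dist.toReal ≤ η` (and `dist < ofReal ε`). [folklore] -/
theorem modulus_le_of_lt_min {C η ε : ℝ} (hη : 0 < η) {d : ℝ≥0∞}
    (hd : d < ENNReal.ofReal (min ε ((η / (|C| + 1)) ^ 2))) :
    C * √d.toReal ≤ η ∧ d < ENNReal.ofReal ε := by
  have hC1 : 0 < |C| + 1 := by positivity
  have hq : 0 < η / (|C| + 1) := div_pos hη hC1
  refine ⟨?_, hd.trans_le (ENNReal.ofReal_le_ofReal (min_le_left _ _))⟩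
  have hd2 : d < ENNReal.ofReal ((η / (|C| + 1)) ^ 2) :=
    hd.trans_le (ENNReal.ofReal_le_ofReal (min_le_right _ _))
  have hdtop : d ≠ ⊤ := ne_top_of_lt hd2
  have hdreal : d.toReal < (η / (|C| + 1)) ^ 2 := by
    have := (ENNReal.toReal_lt_toReal hdtop ENNReal.ofReal_ne_top).2 hd2
    rwa [ENNReal.toReal_ofReal (sq_nonneg _)] at this
  have hsqrt : √d.toReal < η / (|C| + 1) := by
    calc √d.toReal < √((η / (|C| + 1)) ^ 2) :=
          Real.sqrt_lt_sqrt ENNReal.toReal_nonneg hdreal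
      _ = η / (|C| + 1) := Real.sqrt_sq hq.le
  have hsq0 : 0 ≤ √d.toReal := Real.sqrt_nonneg _
  calc C * √d.toReal ≤ |C| * √d.toReal := by
        exact mul_le_mul_of_nonneg_right (le_abs_self C) hsq0
    _ ≤ |C| * (η / (|C| + 1)) := by
        exact mul_le_mul_of_nonneg_left hsqrt.le (abs_nonneg C)
    _ ≤ (|C| + 1) * (η / (|C| + 1)) := by
        exact mul_le_mul_of_nonneg_right (by linarith) hq.le
    _ = η := by field_simp

/-- **The `k := 2` member of the `BulkKerrCapture` family implies `BulkKerrCaptureC2`.** Given, for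
every `a₁ < 1`, a package `(s, δ)` and per mass a basin `ε` and a Lipschitz constant `C` with `C²`
capture and modulus `C √dist` on `|a| ≤ a₁ M`, the successor's qualitative modulus `∀ η ∃ ε` holds
with `ε' = min ε (η / (|C| + 1))²`; the b-conormality side condition is not used. [folklore] -/
theorem bulkKerrCaptureC2_of_captureAt_two
    (h : ∀ [Kerr.Facts] [Kerr.SliceFacts], ∀ a₁ : ℝ, a₁ < 1 → ∃ (s : ℕ) (δ : ℝ),
      ∀ (M : ℝ) (hM : 0 < M), ∃ ε > (0 : ℝ), ∃ C : ℝ, ∀ a : ℝ, |a| ≤ a₁ * M →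
        CaptureAt s δ 2 M hM.le ε C a) :
    BulkKerrCaptureC2 := by
  rw [bulkKerrCaptureC2_iff]
  intro _ _ a₁ ha₁
  obtain ⟨s, δ, hsδ⟩ := h a₁ ha₁
  refine ⟨s, δ, fun M hM η hη ↦ ?_⟩
  obtain ⟨ε, hε, C, hC⟩ := hsδ M hM
  have hq : 0 < η / (|C| + 1) := div_pos hη (by positivity)
  refine ⟨min ε ((η / (|C| + 1)) ^ 2), lt_min hε (pow_pos hq 2), ?_⟩
  intro a ha D _ hvac _ hdist 𝒟 hmax
  obtain ⟨hmodη, hdistε⟩ := modulus_le_of_lt_min (C := C) hη hdist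
  obtain ⟨M', a', 𝒟oc, hsub, hfar, hconv, hmod⟩ := hC a ha D hvac hdistε 𝒟 hmax
  exact ⟨M', a', 𝒟oc, hsub, hfar, hconv, hmod.trans hmodη⟩

/-- **`BulkKerrCapture` plus the `C⁰ → C²` block upgrade gives `BulkKerrCaptureC2`.** The upgrade
hypothesis is the registered stub signature `CaptureUpgrade` of the crux line
`old-light-forces-soft-burial` (`Cruxes/CaptureSuffices/Lines/old-light-forces-soft-burial.lean`):
whatever order `k` the existential of `BulkKerrCapture` supplies is lowered to `0`
(`captureAt_anti`) and raised to `2` by the upgrade. [folklore] -/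
theorem bulkKerrCaptureC2_of_bulkKerrCapture_of_captureUpgrade
    (hup : ∀ [Kerr.Facts] [Kerr.SliceFacts] (s : ℕ) (δ : ℝ) (M : ℝ) (hM : 0 < M) (ε C a : ℝ),
      CaptureAt s δ 0 M hM.le ε C a → CaptureAt s δ 2 M hM.le ε C a)
    (hB : BulkKerrCapture) : BulkKerrCaptureC2 := by
  refine bulkKerrCaptureC2_of_captureAt_two fun a₁ ha₁ ↦ ?_
  obtain ⟨s, δ, k, hk⟩ := bulkKerrCapture_iff.1 hB a₁ ha₁
  refine ⟨s, δ, fun M hM ↦ ?_⟩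
  obtain ⟨ε, hε, C, hC⟩ := hk M hM
  exact ⟨ε, hε, C, fun a ha ↦ hup s δ M hM ε C a (captureAt_anti (Nat.zero_le k) (hC a ha))⟩

/-- **The route file's Assembly note, kernel-checked**: the `C⁰ → C²` block upgrade (stub signature
`CaptureUpgrade`) and the successor crux `CaptureSufficesC2` imply the item. [folklore] -/
theorem captureSuffices_of_captureUpgrade
    (hup : ∀ [Kerr.Facts] [Kerr.SliceFacts] (s : ℕ) (δ : ℝ) (M : ℝ) (hM : 0 < M) (ε C a : ℝ),
      CaptureAt s δ 0 M hM.le ε C a → CaptureAt s δ 2 M hM.le ε C a)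
    (hS : CaptureSufficesC2) : CaptureSuffices :=
  captureSuffices_of_bulkUpgrade (bulkKerrCaptureC2_of_bulkKerrCapture_of_captureUpgrade hup) hS

end Summit.FinalStateConjecture.FinalStateConjecture.Theorems.PhaseMixingCaptureCaptureSuffices

end
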